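import Mathlib
import HarnessLib
import Summits.HubbardSuperconductivity.HubbardSuperconductivity.Theorems.ComplexGFFStiffnessHypACumulantGNV
import Literature.MathematicalPhysics.StatisticalMechanics.TorusFRDHolds
import Summits.HubbardSuperconductivity.HubbardSuperconductivity.Theorems.ComplexGFFStiffnessHypACumulantZOfGNV

/-!
# Crux `HypACumulant` (and `HypALocalTwoPoint`), line `gnv` — the registered research stub
# `stub_gnvOfFrd : TorusFRD 4 → GNV`, PROVED

Route `route-HubbardSuperconductivity-ComplexGFFStiffness`, crux items stmt-HubbardSuperconductivity-19154
(`HypACumulant`) and stmt-HubbardSuperconductivity-19155 (`HypALocalTwoPoint`), whose registered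
skeletons `Cruxes/{HypACumulant,HypALocalTwoPoint}/Lines/gnv.lean` share the research stub
`stub_gnvOfFrd : TorusFRD 4 → GNV` — generalised non-vanishing of the perturbed partition functions
`∫ e^{−S_0} ∏_x (1 + K(∇φ(x)))` on `(ℤ/L^N)^4`, uniformly in `N`, for `ι`-admissible complex single-site
gradient perturbations ([ABKM19] Theorem 2.2, representation half, on the `ι`-symmetric class).
Here it is a theorem: `…HypACumulantGNV.gnv_of_torusFRD`.

Honest framing: this closes the stub `stub_gnvOfFrd` of both skeletons BY NAME; together with the
landed `stub_frd` it makes `GNV` (hence `ZNonvanishing`, via `zNonvanishing_of_gnv`) a theorem of the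
tree.  It does NOT close either crux (`stub_cumulantGivenZ`, `stub_twoPointGivenZ` remain open) and says
nothing about superconductivity in the Hubbard model.

## References
* S. Adams, S. Buchholz, R. Kotecký, S. Müller, arXiv:1910.13564, Theorem 2.2 [AdamsBuchholzKoteckyMuller2019].
-/

noncomputable section

-- `Summit.<Summit>.<Problem>`: single-conjunct summit, the duplicate component is mandated (D-0017).
set_option linter.dupNamespace false

namespace Summit.HubbardSuperconductivity.HubbardSuperconductivity.Theorems.ComplexGFF

/-- **Stub 1b `stub_gnvOfFrd` of the line `gnv` — PROVED**: the finite-range decomposition of the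
torus Green's functions (`TorusFRD 4`, Buchholz 2018 Thm 2.4) implies generalised non-vanishing `GNV`
([ABKM19] Theorem 2.2, representation half, `ι`-symmetric complex class). -/
theorem stub_gnvOfFrd : Literature.MathematicalPhysics.StatisticalMechanics.GradientFRD.TorusFRD 4 → GNV :=
  gnv_of_torusFRD

/-- `GNV` unconditionally (the finite-range decomposition is the Literature theorem `TorusFRD_holds 4`). -/
theorem gnv : GNV :=
  gnv_of_torusFRD (Literature.MathematicalPhysics.StatisticalMechanics.GradientFRD.TorusFRD_holds 4)

/-- **The first rung of both cruxes, `ZNonvanishing`, is a theorem**: `N`-uniform non-vanishing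
`Z_{L^N}(g, 0) ≠ 0` of the untilted complex partition function of the model (the landed reduction
`zNonvanishing_of_gnv` applied to `gnv`).  This is the statement the birth skeletons of `HypACumulant`
(stmt-…-19154) and `HypALocalTwoPoint` (stmt-…-19155) registered as `stub_zNonvanishing`. -/
theorem zNonvanishing : ZNonvanishing :=
  zNonvanishing_of_gnv gnv

end Summit.HubbardSuperconductivity.HubbardSuperconductivity.Theorems.ComplexGFF

end
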